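import Literature.MathematicalPhysics.KineticTheory.ReyBelletThomas2002Flow
import Literature.MathematicalPhysics.KineticTheory.ConfinedDriftKernel
import HarnessLib

/-!
# Rey-Bellet–Thomas 2002: the transition kernels of (RBT-SDE) — Markov, measurable, Feller, Chapman–Kolmogorov

Topic `Literature/MathematicalPhysics/KineticTheory` (trunk T-KINETIC). Provefact unit for the
named fact `ReyBelletThomas2002_thm21` (`ReyBelletThomas2002.lean`); second layer of the
CONSTRUCTION of the Markov semigroup of (RBT-SDE) (RBT §2: "The solution `x(t)` of Eq. (12) is a
Markov process. We denote `T^t` the associated semigroup … and `P_t(x, dy)` the transition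
probability"). The SDE (RBT-SDE) is `dz = X₀(z) dt + v_L dω_L + v_R dω_R` with the drift
`X₀ = rbDrift` and the two CONSTANT reservoir noise vectors `v_b = (2γT_b)^{1/2} ∂_{r_b}`; its drift
is confined by the energy (`rbConfinedDrift`, `ReyBelletThomas2002Flow.lean`) and the `v_b` lie in the
reservoir subspace, so the model-free construction of `ConfinedDriftKernel.lean` applies verbatim:

* `OscillatorChain.rbNoiseVec` — `v_b = √(2γT_b) ∂_{r_b}`;
  `OscillatorChain.rbSolMap`, `OscillatorChain.rbKernel` — the solution map driven by a pair of
  raw paths and the transition kernels `P_t(x, ·) = law(Φ_t(x, B))` of (RBT-SDE);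
* for H1 potentials (growth exponents `≥ 1`), `γ ≥ 0` and any `Λ, N, T_L, T_R`: the kernels are
  Markov (`isMarkovKernel_rbKernel`: no explosion — RBT Lemma 3.5: "the Markov process `x(t)` is
  non-explosive"), jointly measurable in `(t, x)`, `P_0 = id`, satisfy Chapman–Kolmogorov
  `P_{s+t} = P_t ∘ₖ P_s` (`rbKernel_add`) and the Feller property
  (`continuous_integral_rbKernel_bcf`), and `P^t g(x) = E g(Φ_t(x, B))`.

What remains for an instance of `MarkovSemigroupFor (P.rbGenerator Λ N T_L T_R)` is exactly
Dynkin's identity on `C_c^∞` for these kernels (Itô's formula; for the constant noise vectors the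
generator of the SDE is `X₀ f + ½ ∑_b D²f(v_b, v_b) = X₀ f + γ(T_L ∂²_{r_L} + T_R ∂²_{r_R}) f = L f`,
`rbGenerator_eq_hormanderOp`).

## References

* L. Rey-Bellet, L. E. Thomas, Comm. Math. Phys. **225** (2002) 305–329 (arXiv:math-ph/0110024),
  §2 eq. (12)–(13) and the paragraph after (12); Lemma 3.5.
-/

noncomputable section

open MeasureTheory ProbabilityTheory Filter Set
open scoped NNReal ENNReal

namespace Literature.MathematicalPhysics.KineticTheory.HeatConduction

open Literature.Probability.Process

variable {N : ℕ}

namespace OscillatorChain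

variable (P : OscillatorChain)

/-- The constant reservoir noise vectors `v_L = √(2γT_L) ∂_{r_L}`, `v_R = √(2γT_R) ∂_{r_R}` of
(RBT-SDE), `dr_b = (-γ r_b + λ p_b) dt + (2γT_b)^{1/2} dω_b`. Junk value: `v_b = 0` when
`γ T_b < 0` (`Real.sqrt` of a negative number); the non-junk regime is `γ T_b ≥ 0`, the hypothesis
under which the generator `L` of eq. (13) is identified with the Hörmander / Itô form
(`OscillatorChain.rbGenerator_eq_hormanderOp`, `ReyBelletThomas2002Hormander.lean`; the Itô form
`Df·X₀ + ½∑_b D²f[v_b,v_b]` is the subject of the forthcoming `ReyBelletThomas2002Semigroup.lean`).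
[cite: ReyBelletThomas2002, §2 eq. (12)] -/
def rbNoiseVec (N : ℕ) (T_L T_R : ℝ) : Fin 2 → RBPhaseSpace N :=
  ![Real.sqrt (2 * P.γ * T_L) • rbUnitRL, Real.sqrt (2 * P.γ * T_R) • rbUnitRR]

/-- The reservoir noise vectors lie in the reservoir subspace. [folklore] -/
theorem rbNoiseVec_mem (N : ℕ) (T_L T_R : ℝ) (b : Fin 2) : P.rbNoiseVec N T_L T_R b ∈ rbNoise N := by
  fin_cases b
  · exact (rbNoise N).smul_mem _ (zero_prod_mem_rbNoise (N := N) (1, 0))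
  · exact (rbNoise N).smul_mem _ (zero_prod_mem_rbNoise (N := N) (0, 1))

/-- **The solution map of (RBT-SDE)** driven by the pair of raw reservoir-noise paths `w`:
`Φ_t(x, w) = drivenFlow X₀ x n(w) t`, `n(w)(t) = (w̄_L(t⁺) - w̄_L(0)) v_L + (w̄_R(t⁺) - w̄_R(0)) v_R`
(`pairNoise`; on the Brownian pair `n(t) = B^L_{t⁺} v_L + B^R_{t⁺} v_R`).
[cite: ReyBelletThomas2002, §2 eq. (12)] -/
def rbSolMap (Λ : ℝ) (N : ℕ) (T_L T_R : ℝ) (t : ℝ) (x : RBPhaseSpace N) (w : WienerPair) :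
    RBPhaseSpace N :=
  sdeSolMap (P.rbDrift Λ N) (P.rbNoiseVec N T_L T_R 0) (P.rbNoiseVec N T_L T_R 1) t x w

/-- **The transition kernels `P_t(x, ·) = law(Φ_t(x, B))` of (RBT-SDE)** ("`P_t(x, dy)` the
transition probability of the Markov process `x(t)`"), `B` the pair of independent Brownian
motions. [cite: ReyBelletThomas2002, §2 (after eq. (13))] -/
def rbKernel (Λ : ℝ) (N : ℕ) (T_L T_R : ℝ) (t : ℝ≥0) : Kernel (RBPhaseSpace N) (RBPhaseSpace N) :=
  sdeKernel (P.rbDrift Λ N) (P.rbNoiseVec N T_L T_R 0) (P.rbNoiseVec N T_L T_R 1) t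

section Kernel

variable {P} {k₁ k₂ : ℝ} (hU : RBGrowth P.U k₁) (hV : RBGrowth P.V k₂) (hk₁ : 1 ≤ k₁) (hk₂ : 1 ≤ k₂)
  (hγ : 0 ≤ P.γ) (Λ : ℝ) (N : ℕ) (T_L T_R : ℝ)
include hU hV hk₁ hk₂ hγ

/-- `P_t(x, ·)` is the law of the solution map driven by the Brownian pair (no junk).
[cite: ReyBelletThomas2002, §2 (after eq. (13))] -/
theorem rbKernel_apply (t : ℝ≥0) (x : RBPhaseSpace N) :
    P.rbKernel Λ N T_L T_R t x = wienerPair.map fun ω => P.rbSolMap Λ N T_L T_R t x (pairPath ω) :=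
  (P.rbConfinedDrift hU hV hk₁ hk₂ hγ Λ N).sdeKernel_apply (P.rbNoiseVec_mem N T_L T_R 0)
    (P.rbNoiseVec_mem N T_L T_R 1) t x

/-- `P^t g(x) = E g(Φ_t(x, B))` for measurable `g ≥ 0`. [cite: ReyBelletThomas2002, §2 (semigroup T^t)] -/
theorem lintegral_rbKernel (t : ℝ≥0) (x : RBPhaseSpace N) {g : RBPhaseSpace N → ℝ≥0∞}
    (hg : Measurable g) :
    ∫⁻ y, g y ∂(P.rbKernel Λ N T_L T_R t x) = ∫⁻ ω, g (P.rbSolMap Λ N T_L T_R t x (pairPath ω)) ∂wienerPair :=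
  (P.rbConfinedDrift hU hV hk₁ hk₂ hγ Λ N).lintegral_sdeKernel (P.rbNoiseVec_mem N T_L T_R 0)
    (P.rbNoiseVec_mem N T_L T_R 1) t x hg

/-- `P^t g(x) = E g(Φ_t(x, B))` for continuous (indeed ae-strongly measurable) real `g`.
[cite: ReyBelletThomas2002, §2 (semigroup T^t)] -/
theorem integral_rbKernel (t : ℝ≥0) (x : RBPhaseSpace N) {g : RBPhaseSpace N → ℝ}
    (hg : AEStronglyMeasurable g (P.rbKernel Λ N T_L T_R t x)) :
    ∫ y, g y ∂(P.rbKernel Λ N T_L T_R t x) = ∫ ω, g (P.rbSolMap Λ N T_L T_R t x (pairPath ω)) ∂wienerPair :=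
  (P.rbConfinedDrift hU hV hk₁ hk₂ hγ Λ N).integral_sdeKernel (P.rbNoiseVec_mem N T_L T_R 0)
    (P.rbNoiseVec_mem N T_L T_R 1) t x hg

/-- **No explosion**: the transition kernels of (RBT-SDE) are Markov kernels (RBT Lemma 3.5: "the
Markov process `x(t)` is non-explosive"). [cite: ReyBelletThomas2002, Lemma 3.5] -/
theorem isMarkovKernel_rbKernel (t : ℝ≥0) : IsMarkovKernel (P.rbKernel Λ N T_L T_R t) :=
  (P.rbConfinedDrift hU hV hk₁ hk₂ hγ Λ N).isMarkovKernel_sdeKernel (P.rbNoiseVec_mem N T_L T_R 0)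
    (P.rbNoiseVec_mem N T_L T_R 1) t

/-- Joint measurability of `(t, x) ↦ P_t(x, ·)`. [folklore] -/
theorem measurable_rbKernel : Measurable fun p : ℝ≥0 × RBPhaseSpace N => P.rbKernel Λ N T_L T_R p.1 p.2 :=
  (P.rbConfinedDrift hU hV hk₁ hk₂ hγ Λ N).measurable_sdeKernel (P.rbNoiseVec_mem N T_L T_R 0)
    (P.rbNoiseVec_mem N T_L T_R 1)

/-- `P_0 = id`. [folklore] -/
theorem rbKernel_zero : P.rbKernel Λ N T_L T_R 0 = Kernel.id :=
  (P.rbConfinedDrift hU hV hk₁ hk₂ hγ Λ N).sdeKernel_zero (P.rbNoiseVec_mem N T_L T_R 0)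
    (P.rbNoiseVec_mem N T_L T_R 1)

/-- **Chapman–Kolmogorov** `P_{s+t} = P_t ∘ₖ P_s` for (RBT-SDE) ("The solution `x(t)` of Eq. (12) is a
Markov process"). [cite: ReyBelletThomas2002, §2 (after eq. (12))] -/
theorem rbKernel_add (s t : ℝ≥0) :
    P.rbKernel Λ N T_L T_R (s + t) = P.rbKernel Λ N T_L T_R t ∘ₖ P.rbKernel Λ N T_L T_R s :=
  (P.rbConfinedDrift hU hV hk₁ hk₂ hγ Λ N).sdeKernel_add (P.rbNoiseVec_mem N T_L T_R 0)
    (P.rbNoiseVec_mem N T_L T_R 1) s t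

/-- **The Feller property** of the transition kernels of (RBT-SDE): `x ↦ P^t g(x)` is continuous
for bounded continuous `g`. [cite: ReyBelletThomas2002, §4 ("strong Feller")] -/
theorem continuous_integral_rbKernel (t : ℝ≥0) {g : RBPhaseSpace N → ℝ} (hg : Continuous g) {C : ℝ}
    (hC : ∀ y, ‖g y‖ ≤ C) : Continuous fun x => ∫ y, g y ∂(P.rbKernel Λ N T_L T_R t x) :=
  (P.rbConfinedDrift hU hV hk₁ hk₂ hγ Λ N).continuous_integral_sdeKernel (P.rbNoiseVec_mem N T_L T_R 0)
    (P.rbNoiseVec_mem N T_L T_R 1) t hg hC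

/-- The Feller property, `BoundedContinuousFunction` form. [folklore] -/
theorem continuous_integral_rbKernel_bcf (t : ℝ≥0) (g : BoundedContinuousFunction (RBPhaseSpace N) ℝ) :
    Continuous fun x => ∫ y, g y ∂(P.rbKernel Λ N T_L T_R t x) :=
  (P.rbConfinedDrift hU hV hk₁ hk₂ hγ Λ N).continuous_integral_sdeKernel_bcf (P.rbNoiseVec_mem N T_L T_R 0)
    (P.rbNoiseVec_mem N T_L T_R 1) t g

/-- The solution map is continuous in time. [folklore] -/
theorem continuous_rbSolMap (x : RBPhaseSpace N) (w : WienerPair) :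
    Continuous fun t => P.rbSolMap Λ N T_L T_R t x w :=
  (P.rbConfinedDrift hU hV hk₁ hk₂ hγ Λ N).continuous_sdeSolMap (P.rbNoiseVec_mem N T_L T_R 0)
    (P.rbNoiseVec_mem N T_L T_R 1) x w

/-- The solution map is continuous in the initial condition. [folklore] -/
theorem continuous_rbSolMap_left (t : ℝ) (w : WienerPair) :
    Continuous fun x => P.rbSolMap Λ N T_L T_R t x w :=
  (P.rbConfinedDrift hU hV hk₁ hk₂ hγ Λ N).continuous_sdeSolMap_left (P.rbNoiseVec_mem N T_L T_R 0)
    (P.rbNoiseVec_mem N T_L T_R 1) t w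

/-- The solution map driven by the Brownian pair is jointly measurable in `(x, ω)`. [folklore] -/
theorem measurable_rbSolMap_pairPath (t : ℝ) :
    Measurable fun p : RBPhaseSpace N × WienerPair => P.rbSolMap Λ N T_L T_R t p.1 (pairPath p.2) :=
  (P.rbConfinedDrift hU hV hk₁ hk₂ hγ Λ N).measurable_sdeSolMap_pairPath (P.rbNoiseVec_mem N T_L T_R 0)
    (P.rbNoiseVec_mem N T_L T_R 1) t

/-- Measurability of the solution map driven by the Brownian pair, for fixed `x`. [folklore] -/
theorem measurable_rbSolMap_pairPath_right (t : ℝ) (x : RBPhaseSpace N) :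
    Measurable fun ω : WienerPair => P.rbSolMap Λ N T_L T_R t x (pairPath ω) :=
  (P.rbConfinedDrift hU hV hk₁ hk₂ hγ Λ N).measurable_sdeSolMap_pairPath_right
    (P.rbNoiseVec_mem N T_L T_R 0) (P.rbNoiseVec_mem N T_L T_R 1) t x

end Kernel

end OscillatorChain

end Literature.MathematicalPhysics.KineticTheory.HeatConduction
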